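import Summits.ResolutionOfSingularities.ResolutionOfSingularities.Theorems.EquisingularLiftEquisingularLiftNatResidueHypDefs6
import Summits.ResolutionOfSingularities.ResolutionOfSingularities.Theorems.EquisingularLiftEquisingularLiftNatNoseResidueUnfoldNu
import HarnessLib

/-!
# [OURS · L1 W4.5(b) · EL♮(3)] NOSE RESIDUE STRUCTURE, brick 12 — the HOSTED-NEST nose hypothesis `NoseHypHostedNestBTriplePrime` (D4-1 ✓ p661159,
# hypothesis #18′ of the 39th's nose residue) UNFOLDED, and its place among the nose hypotheses

Cell `res-hironaka`, rung L, slot W4.5(b), width seat `res-L1-w45b-nose-w4` (row NOSE RESIDUE STRUCTURE; WIDTH TABLE D4); crux CHILD EL♮(3) =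
stmt-ResolutionOfSingularities-20148. OURS; NOT a statement of any manuscript; nothing of [Hironaka2017] is asserted or used; AI kernel work, weaker than expert
review. Resolution of singularities in positive characteristic is NOT proved here. No `sorry`, no new definition, no instance, no notation; standard axioms.
`--kind proof --supports stmt-ResolutionOfSingularities-20148 --as helper`.  Pattern of bricks 1a (✓ p642768) and 10 (✓ p649219).

* `not_noseHypHostedNestBTriplePrime_iff` — `H` ESCAPES the hosted-NEST points-first nose (ν2ʰ⁺ᴺ) iff for every admissible initial host `E₀` (`∅`, or a hyperplane
  `V₊(ℓ) ⊉ ι(H)`) and every stage `(F', ρ', T')` reached from `(ℙⁿ, 𝟙, ι(H), E₀)` by the hosted point steps, the hosted rounds (regular curve `Z ⊆ closure E ∩ T`,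
  host and ambient regular along it, `DirStepUnobs` IN THE HOST) and the hosted/free nose moves `ReachHostedNoseBTriplePrime`, the reduced strict transform
  `closure T'` is NON-regular.
* `not_noseHypPointsFirstBTriplePrime_of_not_hostedNest'` — the residue-side monotonicity `¬ν2ʰ⁺ᴺ → ¬ν2` re-exported next to the unfoldings (027's
  `noseHypHostedNestBTriplePrime_of_pointsFirst` BY NAME; so in the 39th's residue `¬ν2` is implied by `#18′`, while `¬ν1`, `¬B‴`, `¬B″`, `¬LC₂` stay as listed).
* Customer of record inhabiting ν2ʰ⁺ᴺ ∖ (LC₂ ∪ B″ ∪ B‴ ∪ ν1 ∪ ν2) (by hand + kernel algebra ✓ p659973/p660538): S_ν(4) = V((x²y²+y²z²+z²x²)² + w²B♮), char ∉ {2,7,503,129449}.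
-/

set_option linter.dupNamespace false

noncomputable section

open CategoryTheory CategoryTheory.Limits AlgebraicGeometry TopologicalSpace Topology IsLocalRing
open Literature.AlgebraicGeometry.Resolution
open Literature.AlgebraicGeometry.Motives
open AlgebraicGeometry.Scheme.IdealSheafData
open Summit.ResolutionOfSingularities.ResolutionOfSingularities.Cruxes.EquisingularLift.StrataSplit

namespace Summit.ResolutionOfSingularities.ResolutionOfSingularities.Cruxes.EquisingularLiftNat.Sections

/-- **`¬ NoseHypHostedNestBTriplePrime`, unfolded** (hypothesis #18′ of the 39th's nose residue, D4-1 ✓ p661159): `H` escapes the hosted-NEST points-first nose iff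
for every admissible initial host `E₀` and every stage reached by the hosted motive's three closure rules the reduced strict transform is NON-regular.
[OURS · L1 W4.5b · pure logic] -/
theorem not_noseHypHostedNestBTriplePrime_iff (k : Type) [Field k] [IsAlgClosed k] (n : ℕ) (H : AlgebraicGeometry.Scheme.{0})
    (ι : H ⟶ (Literature.AlgebraicGeometry.Motives.projectiveSpace n k).left) :
    letI := MvPolynomial.gradedAlgebra (σ := Fin (n + 1)) (R := k)
    ¬ NoseHypHostedNestBTriplePrime k n H ι ↔
      ∀ (E₀ : Set (Literature.AlgebraicGeometry.Motives.projectiveSpace n k).left),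
        ((E₀ = ∅ ∨ ∃ ℓ : MvPolynomial (Fin (n + 1)) k, ℓ.IsHomogeneous 1 ∧ ℓ ≠ 0 ∧
      ¬ (Set.range ι ⊆ {y : (Literature.AlgebraicGeometry.Motives.projectiveSpace n k).left |
        ℓ ∈ (y : ProjectiveSpectrum (MvPolynomial.homogeneousSubmodule (Fin (n + 1)) k)).asHomogeneousIdeal}) ∧
      E₀ = {y : (Literature.AlgebraicGeometry.Motives.projectiveSpace n k).left |
        ℓ ∈ (y : ProjectiveSpectrum (MvPolynomial.homogeneousSubmodule (Fin (n + 1)) k)).asHomogeneousIdeal})) →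
        ∀ (F' : AlgebraicGeometry.Scheme.{0}) (ρ' : F' ⟶ (Literature.AlgebraicGeometry.Motives.projectiveSpace n k).left) (T' : Set F'),
          ((∀ Q : (∀ F₁ : AlgebraicGeometry.Scheme.{0}, (F₁ ⟶ (Literature.AlgebraicGeometry.Motives.projectiveSpace n k).left) → Set F₁ → Set F₁ → Prop),
        Q (Literature.AlgebraicGeometry.Motives.projectiveSpace n k).left (𝟙 (Literature.AlgebraicGeometry.Motives.projectiveSpace n k).left) (Set.range ι) E₀ →
        (∀ (F₁ F₂ : AlgebraicGeometry.Scheme.{0}) (ρ : F₁ ⟶ (Literature.AlgebraicGeometry.Motives.projectiveSpace n k).left) (T₁ E₁ : Set F₁)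
            (x : ↥((AlgebraicGeometry.Scheme.IdealSheafData.vanishingIdeal (⟨closure T₁, isClosed_closure⟩ : TopologicalSpace.Closeds F₁))).subscheme) (υ : F₂ ⟶ F₁) (hx : IsClosed ({(((AlgebraicGeometry.Scheme.IdealSheafData.vanishingIdeal (⟨closure T₁, isClosed_closure⟩ : TopologicalSpace.Closeds F₁))).subschemeι x : F₁)} : Set F₁)),
          Q F₁ ρ T₁ E₁ → ¬ IsRegularLocalRing (((AlgebraicGeometry.Scheme.IdealSheafData.vanishingIdeal (⟨closure T₁, isClosed_closure⟩ : TopologicalSpace.Closeds F₁))).subscheme.presheaf.stalk x) →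
          IsRegularLocalRing (F₁.presheaf.stalk (((AlgebraicGeometry.Scheme.IdealSheafData.vanishingIdeal (⟨closure T₁, isClosed_closure⟩ : TopologicalSpace.Closeds F₁))).subschemeι x : F₁)) →
          ((((AlgebraicGeometry.Scheme.IdealSheafData.vanishingIdeal (⟨closure T₁, isClosed_closure⟩ : TopologicalSpace.Closeds F₁))).subschemeι x : F₁) ∈ closure E₁ → ∀ e : ↥(redSub F₁ (closure E₁) isClosed_closure), (redSubι F₁ (closure E₁) isClosed_closure e : F₁) = (((AlgebraicGeometry.Scheme.IdealSheafData.vanishingIdeal (⟨closure T₁, isClosed_closure⟩ : TopologicalSpace.Closeds F₁))).subschemeι x : F₁) →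
          IsRegularLocalRing ((redSub F₁ (closure E₁) isClosed_closure).presheaf.stalk e)) → Literature.AlgebraicGeometry.Resolution.IsBlowup υ
            (AlgebraicGeometry.Scheme.IdealSheafData.vanishingIdeal (⟨{(((AlgebraicGeometry.Scheme.IdealSheafData.vanishingIdeal (⟨closure T₁, isClosed_closure⟩ : TopologicalSpace.Closeds F₁))).subschemeι x : F₁)}, hx⟩ : TopologicalSpace.Closeds F₁)) →
          Q F₂ (υ ≫ ρ) (closure (υ ⁻¹' (T₁ \ {(((AlgebraicGeometry.Scheme.IdealSheafData.vanishingIdeal (⟨closure T₁, isClosed_closure⟩ : TopologicalSpace.Closeds F₁))).subschemeι x : F₁)}))) (closure (υ ⁻¹' (E₁ \ {(((AlgebraicGeometry.Scheme.IdealSheafData.vanishingIdeal (⟨closure T₁, isClosed_closure⟩ : TopologicalSpace.Closeds F₁))).subschemeι x : F₁)})))) →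
        -- STAGE-LEVEL HOSTED ROUND at a regular curve `Z` inside the host, unobstructed IN THE HOST (in-host NEST lines and the nose curve alike)
        (∀ (F₁ F₃ : AlgebraicGeometry.Scheme.{0}) (ρ : F₁ ⟶ (Literature.AlgebraicGeometry.Motives.projectiveSpace n k).left) (T₁ E₁ : Set F₁) (Z : Set F₁) (hZ : IsClosed Z) (υ' : F₃ ⟶ F₁),
          Q F₁ ρ T₁ E₁ → Z ⊆ closure E₁ → Z ⊆ T₁ → ¬ T₁ ⊆ Z → (∀ z : ↥(redSub F₁ Z hZ), IsRegularLocalRing ((redSub F₁ Z hZ).presheaf.stalk z)) →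
          (∀ (i : redSub F₁ Z hZ ⟶ redSub F₁ (closure E₁) isClosed_closure), i ≫ redSubι F₁ (closure E₁) isClosed_closure = redSubι F₁ Z hZ →
            ∀ z : ↥(redSub F₁ Z hZ), IsRegularLocalRing ((redSub F₁ (closure E₁) isClosed_closure).presheaf.stalk (i z))) → DirStepUnobs F₁ (closure E₁) isClosed_closure Z hZ →
          Literature.AlgebraicGeometry.Resolution.IsBlowup υ' (AlgebraicGeometry.Scheme.IdealSheafData.vanishingIdeal (⟨Z, hZ⟩ : TopologicalSpace.Closeds F₁)) →
          Q F₃ (υ' ≫ ρ) (closure (υ' ⁻¹' (T₁ \ Z))) (closure (υ' ⁻¹' (closure E₁ \ Z)))) →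
        (∀ (F₁ : AlgebraicGeometry.Scheme.{0}) (ρ : F₁ ⟶ (Literature.AlgebraicGeometry.Motives.projectiveSpace n k).left) (T₁ E₁ : Set F₁) (F₉ : AlgebraicGeometry.Scheme.{0}) (β : F₉ ⟶ F₁) (T₉ E₉ : Set F₉),
          Q F₁ ρ T₁ E₁ → ReachHostedNoseBTriplePrime F₁ T₁ E₁ F₉ β T₉ E₉ → Q F₉ (β ≫ ρ) T₉ E₉) → ∃ E' : Set F', Q F' ρ' T' E')) →
          ¬ Literature.AlgebraicGeometry.Resolution.Scheme.IsRegular (AlgebraicGeometry.Scheme.IdealSheafData.vanishingIdeal (⟨closure T', isClosed_closure⟩ : TopologicalSpace.Closeds F')).subscheme := by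
  constructor
  · intro h E₀ hE₀ F' ρ' T' hcl hreg
    exact h ⟨E₀, hE₀, F', ρ', T', hcl, hreg⟩
  · rintro h ⟨E₀, hE₀, F', ρ', T', hcl, hreg⟩
    exact h E₀ hE₀ F' ρ' T' hcl hreg

/-- **Residue-side monotonicity** `¬ν2ʰ⁺ᴺ → ¬ν2` (027's inclusion lemma, contrapositive, BY NAME) — in the 39th's residue the replaced `¬ NoseHypPointsFirstBTriplePrime`
is recovered from `#18′`. [OURS · pure logic] -/
theorem not_noseHypPointsFirstBTriplePrime_of_not_hostedNest' (k : Type) [Field k] [IsAlgClosed k] (n : ℕ) (H : AlgebraicGeometry.Scheme.{0})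
    (ι : H ⟶ (Literature.AlgebraicGeometry.Motives.projectiveSpace n k).left) (h : ¬ NoseHypHostedNestBTriplePrime k n H ι) :
    ¬ NoseHypPointsFirstBTriplePrime k n H ι :=
  fun h2 => h (noseHypHostedNestBTriplePrime_of_pointsFirst k n H ι h2)

end Summit.ResolutionOfSingularities.ResolutionOfSingularities.Cruxes.EquisingularLiftNat.Sections

end
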